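import Literature.MathematicalPhysics.QuantumFieldTheory.Balaban1983to89.BlockAveragingFederbush
import Literature.MathematicalPhysics.QuantumLattice.GaugeGroups
import Literature.Analysis.Complex.RungeUnits
import Mathlib.Topology.MetricSpace.Contracting
import HarnessLib

/-!
# Route `UnitScaleTilt` (rung R3), cruxes K1 «MinimiserStabilityRegPr» (stmt-QuantumFields-19200, `stub_smoothLift` (i)) and K1bR-pr
# «FluctuationComparisonRegPr» (stmt-QuantumFields-19201, `stub_oneStepSmallLift` / (O)) — THE ENGINE of the exact corrector for
# Bałaban's block averaging (0.4): the guarded fibre map `W ↦ exp(Σ_i c_i log(h_i W*))·W` of the printed exp-mean-log average is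
# ONTO a neighbourhood of each of its values, with explicit modulus (`SU(N)`, pure matrix analysis)

Cell `ym3-torus` (HUMAN RULING D-0037, YM ladder rung R3), seat `ym3-torus-p1` gen 9; cell record HOME/UV3-NODE.md §18.  WHAT THIS IS NOT:
nothing of Bałaban's is asserted and no lattice appears — this is the one-variable fixed-point lemma behind the lattice corrector of the
sequel `UnitScaleTiltBlockAvgCorrector` (which supplies the private coordinates of `BlockAveragingHaarAC` / `BlockAveragingEMLHaarAC`).

THE POINT.  In the private coordinate `W = pre·U(β(c))·post` of a coarse bond `c`, Bałaban's averaged bond variable is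
`K W = exp(Σ_{k off-central} |I|⁻¹ log(h_k W*))·W` on the guard (`BlockAveragingEMLHaarAC.coe_fibreCore_eq`), the off-central weights
having total `≤ 1 − κ`, `κ = |I|⁻¹ > 0`.  **`exists_eq_of_near`**: for data `‖h_i W₀* − 1‖ ≤ r₀`, a target `Y ∈ SU(N)` with
`‖Y − K W₀‖ ≤ η`, and `r₀ + 2η/κ ≤ κ/16` (the ball of radius `2η/κ` lying in the set where the formula holds), `Y = K W` for some
`W ∈ SU(N)` with `‖W − W₀‖ ≤ 2η/κ`.  Proof: `T W = W (K W)⁻¹ Y = exp(−Σ…)·Y` maps that ball into itself and is a contraction with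
constant `(1 − κ)·e^{2r}/(1 − r) ≤ 1 − κ/2`, `r = r₀ + 2η/κ` — mean-value Lipschitz bounds of the series logarithm
(`FederbushMean.norm_mlog_sub_mlog_le`, [Balaban1985Averaging] (21)/(26)) and of `exp` (`Literature.Analysis.Complex.norm_exp_sub_exp_le`),
`e^{2r}/(1 − r) ≤ 1 + 4r` for `r ≤ 1/8` (`exp_two_mul_div_le`); Banach's fixed point theorem on the compact, hence complete, `SU(N)`
(`ContractingWith.exists_fixedPoint'`).  Elementary; [folklore] throughout.

References: T. Bałaban, CMP 109 (1987) 249–301 [Balaban1987RG1] ((0.4) p.253); CMP 98 (1985) 17–51 [Balaban1985Averaging] ((21), (26) p.21–22).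
-/

noncomputable section

open scoped Matrix.Norms.L2Operator NNReal ENNReal
open NormedSpace Function Set Filter Topology

namespace Summit.QuantumFields.YangMills.Theorems.BlockAvgCorrector

open Literature.MathematicalPhysics.QuantumFieldTheory.Balaban1983to89
open MatrixLog ExpMeanLog

/-! ## §0 `SU(N)` read in `M_N(ℂ)` -/

section Matrices

variable {n : Type*} [Fintype n] [DecidableEq n]

/-- A special unitary matrix has operator norm `1` (nonempty index type). [folklore] -/
private theorem norm_coe_su [Nonempty n] (g : Matrix.specialUnitaryGroup n ℂ) : ‖(g : Matrix n n ℂ)‖ = 1 :=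
  UnitaryModel.norm_of_mem_unitaryGroup (Matrix.specialUnitaryGroup_le_unitaryGroup g.2)

/-- The inverse in `SU(N)` is the adjoint. [folklore] -/
private theorem coe_inv_su (g : Matrix.specialUnitaryGroup n ℂ) :
    ((g⁻¹ : Matrix.specialUnitaryGroup n ℂ) : Matrix n n ℂ) = star (g : Matrix n n ℂ) := rfl

/-- `W W* = 1` for `W ∈ SU(N)`. [folklore] -/
private theorem coe_mul_star_self (g : Matrix.specialUnitaryGroup n ℂ) :
    (g : Matrix n n ℂ) * star (g : Matrix n n ℂ) = 1 :=
  Matrix.mem_unitaryGroup_iff.1 (Matrix.specialUnitaryGroup_le_unitaryGroup g.2)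

/-- `W* W = 1` for `W ∈ SU(N)`. [folklore] -/
private theorem coe_star_mul_self (g : Matrix.specialUnitaryGroup n ℂ) :
    star (g : Matrix n n ℂ) * (g : Matrix n n ℂ) = 1 :=
  Matrix.mem_unitaryGroup_iff'.1 (Matrix.specialUnitaryGroup_le_unitaryGroup g.2)

/-- Left multiplication by a special unitary does not increase the norm: `‖gA‖ ≤ ‖A‖`. [folklore] -/
private theorem norm_coe_mul_le [Nonempty n] (g : Matrix.specialUnitaryGroup n ℂ) (A : Matrix n n ℂ) :
    ‖(g : Matrix n n ℂ) * A‖ ≤ ‖A‖ :=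
  (norm_mul_le _ _).trans (by rw [norm_coe_su, one_mul])

/-- Right multiplication by a special unitary does not increase the norm: `‖Ag‖ ≤ ‖A‖`. [folklore] -/
private theorem norm_mul_coe_le [Nonempty n] (A : Matrix n n ℂ) (g : Matrix.specialUnitaryGroup n ℂ) :
    ‖A * (g : Matrix n n ℂ)‖ ≤ ‖A‖ :=
  (norm_mul_le _ _).trans (by rw [norm_coe_su, mul_one])

end Matrices

/-! ## §1 The engine: the guarded fibre map `W ↦ exp(Σ_i c_i log(h_i W*))·W` is ONTO a neighbourhood, with modulus -/

section Engine

variable {n : Type*} [Fintype n] [DecidableEq n] [Nonempty n] {ι : Type*} [Fintype ι]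

/-- The elementary inequality behind the contraction constant: `e^{2r}/(1 − r) ≤ 1 + 4r` for `0 ≤ r ≤ 1/8`. [folklore] -/
theorem exp_two_mul_div_le {r : ℝ} (h0 : 0 ≤ r) (h8 : r ≤ 1 / 8) : Real.exp (2 * r) / (1 - r) ≤ 1 + 4 * r := by
  have h1 : |2 * r| ≤ 1 := by rw [abs_of_nonneg (by linarith)]; linarith
  have h2 := Real.abs_exp_sub_one_sub_id_le h1
  have h3 : Real.exp (2 * r) ≤ 1 + 2 * r + (2 * r) ^ 2 := by
    have := (abs_le.mp h2).2; linarith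
  rw [div_le_iff₀ (by linarith)]
  nlinarith

/-- **THE ENGINE — FIBRE SURJECTIVITY WITH MODULUS.**  Let `h_i ∈ SU(N)` (`i ∈ I` finite), weights `c_i ≥ 0` of total
`≤ 1 − κ` (`0 < κ ≤ 1`), and `K : SU(N) → SU(N)` a map which ON A SET `S` is the guarded fibre map of the exp-mean-log average,
`K W = exp(Σ_i c_i log(h_i W*))·W` (`log` = the series logarithm).  If at a base point `W₀` the data are small,
`‖h_i W₀* − 1‖ ≤ r₀`, a target `Y ∈ SU(N)` is `η`-close to `K W₀`, the ball of radius `R = 2η/κ` about `W₀` lies in `S`, and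
`r₀ + R ≤ κ/16`, then `Y = K W` for some `W ∈ SU(N)` with `‖W − W₀‖ ≤ R`.  (Banach iteration of `W ↦ W (K W)⁻¹ Y = exp(−Σ…)·Y`
on that ball: Lipschitz constant `(1 − κ)·e^{2r}/(1 − r) ≤ 1 − κ/2`, `r = r₀ + R`.) [folklore] -/
theorem exists_eq_of_near (h : ι → Matrix.specialUnitaryGroup n ℂ) {c : ι → ℝ} (hc : ∀ i, 0 ≤ c i)
    {κ : ℝ} (hκ : 0 < κ) (hκ1 : κ ≤ 1) (hs : ∑ i, c i ≤ 1 - κ)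
    {K : Matrix.specialUnitaryGroup n ℂ → Matrix.specialUnitaryGroup n ℂ} {S : Set (Matrix.specialUnitaryGroup n ℂ)}
    (hKW : ∀ W ∈ S, ((K W : Matrix.specialUnitaryGroup n ℂ) : Matrix n n ℂ) =
      exp (∑ i, (c i : ℂ) • mlog ((h i : Matrix n n ℂ) * star (W : Matrix n n ℂ))) * (W : Matrix n n ℂ))
    {W₀ Y : Matrix.specialUnitaryGroup n ℂ} {r₀ η : ℝ} (hr₀ : 0 ≤ r₀) (hη : 0 ≤ η)
    (hsmall : r₀ + 2 * η / κ ≤ κ / 16)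
    (hS : ∀ W : Matrix.specialUnitaryGroup n ℂ, ‖(W : Matrix n n ℂ) - (W₀ : Matrix n n ℂ)‖ ≤ 2 * η / κ → W ∈ S)
    (hh : ∀ i, ‖(h i : Matrix n n ℂ) * star (W₀ : Matrix n n ℂ) - 1‖ ≤ r₀)
    (hY : ‖(Y : Matrix n n ℂ) - (K W₀ : Matrix n n ℂ)‖ ≤ η) :
    ∃ W : Matrix.specialUnitaryGroup n ℂ, ‖(W : Matrix n n ℂ) - (W₀ : Matrix n n ℂ)‖ ≤ 2 * η / κ ∧ K W = Y := by
  haveI : CompleteSpace (Matrix n n ℂ) := FiniteDimensional.complete ℂ _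
  -- abbreviations
  set R : ℝ := 2 * η / κ with hR_def
  set r : ℝ := r₀ + R with hr_def
  have hR0 : 0 ≤ R := div_nonneg (by positivity) hκ.le
  have hr0 : 0 ≤ r := add_nonneg hr₀ hR0
  have hr16 : r ≤ κ / 16 := hsmall
  have hr8 : r ≤ 1 / 8 := by linarith
  have hr2 : r ≤ 1 / 2 := by linarith
  have hr1 : r < 1 := by linarith
  have hsum0 : 0 ≤ ∑ i, c i := Finset.sum_nonneg fun i _ => hc i
  -- the exponent `M W = Σ_i c_i log(h_i W*)`
  set M : Matrix.specialUnitaryGroup n ℂ → Matrix n n ℂ :=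
    fun W => ∑ i, (c i : ℂ) • mlog ((h i : Matrix n n ℂ) * star (W : Matrix n n ℂ)) with hM_def
  -- the ball
  set s : Set (Matrix.specialUnitaryGroup n ℂ) := {W | ‖(W : Matrix n n ℂ) - (W₀ : Matrix n n ℂ)‖ ≤ R} with hs_def
  have hsS : s ⊆ S := fun W hW => hS W hW
  have hW₀s : W₀ ∈ s := by show ‖(W₀ : Matrix n n ℂ) - W₀‖ ≤ R; rw [sub_self, norm_zero]; exact hR0
  -- data radius on the ball
  have hrad : ∀ W ∈ s, ∀ i, ‖(h i : Matrix n n ℂ) * star (W : Matrix n n ℂ) - 1‖ ≤ r := by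
    intro W hW i
    have h1 : (h i : Matrix n n ℂ) * star (W : Matrix n n ℂ) - 1 =
        ((h i : Matrix n n ℂ) * star (W₀ : Matrix n n ℂ) - 1) + (h i : Matrix n n ℂ) * star ((W : Matrix n n ℂ) - W₀) := by
      rw [star_sub]; noncomm_ring
    rw [h1]
    refine (norm_add_le _ _).trans (add_le_add (hh i) ?_)
    calc ‖(h i : Matrix n n ℂ) * star ((W : Matrix n n ℂ) - W₀)‖ ≤ ‖star ((W : Matrix n n ℂ) - W₀)‖ := norm_coe_mul_le _ _
      _ = ‖(W : Matrix n n ℂ) - W₀‖ := norm_star _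
      _ ≤ R := hW
  -- size of the exponent on the ball
  have hMle : ∀ W ∈ s, ‖M W‖ ≤ 2 * r := by
    intro W hW
    calc ‖M W‖ ≤ ∑ i, ‖(c i : ℂ) • mlog ((h i : Matrix n n ℂ) * star (W : Matrix n n ℂ))‖ := norm_sum_le _ _
      _ ≤ ∑ i, c i * (2 * r) := Finset.sum_le_sum fun i _ => by
          rw [norm_smul, Complex.norm_real, Real.norm_of_nonneg (hc i)]
          refine mul_le_mul_of_nonneg_left ?_ (hc i)
          have hX : ‖(h i : Matrix n n ℂ) * star (W : Matrix n n ℂ) - 1‖ ≤ 1 / 2 := (hrad W hW i).trans hr2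
          exact (norm_mlog_le_two_mul hX).trans (by linarith [hrad W hW i])
      _ = (∑ i, c i) * (2 * r) := by rw [Finset.sum_mul]
      _ ≤ 1 * (2 * r) := mul_le_mul_of_nonneg_right (hs.trans (by linarith)) (by linarith)
      _ = 2 * r := one_mul _
  -- Lipschitz bound of the exponent on the ball
  have hMlip : ∀ W ∈ s, ∀ W' ∈ s, ‖M W - M W'‖ ≤ (1 - κ) * (1 + r / (1 - r)) * ‖(W : Matrix n n ℂ) - W'‖ := by
    intro W hW W' hW'
    have hsub : M W - M W' = ∑ i, (c i : ℂ) • (mlog ((h i : Matrix n n ℂ) * star (W : Matrix n n ℂ)) -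
        mlog ((h i : Matrix n n ℂ) * star (W' : Matrix n n ℂ))) := by
      simp only [hM_def, smul_sub, Finset.sum_sub_distrib]
    rw [hsub]
    calc ‖∑ i, (c i : ℂ) • (mlog ((h i : Matrix n n ℂ) * star (W : Matrix n n ℂ)) -
            mlog ((h i : Matrix n n ℂ) * star (W' : Matrix n n ℂ)))‖
        ≤ ∑ i, ‖(c i : ℂ) • (mlog ((h i : Matrix n n ℂ) * star (W : Matrix n n ℂ)) -
            mlog ((h i : Matrix n n ℂ) * star (W' : Matrix n n ℂ)))‖ := norm_sum_le _ _
      _ ≤ ∑ i, c i * ((1 + r / (1 - r)) * ‖(W : Matrix n n ℂ) - W'‖) := Finset.sum_le_sum fun i _ => by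
          rw [norm_smul, Complex.norm_real, Real.norm_of_nonneg (hc i)]
          refine mul_le_mul_of_nonneg_left ?_ (hc i)
          refine (FederbushMean.norm_mlog_sub_mlog_le hr1 (hrad W hW i) (hrad W' hW' i)).trans ?_
          refine mul_le_mul_of_nonneg_left ?_ (by have := div_nonneg hr0 (by linarith : (0:ℝ) ≤ 1 - r); linarith)
          have h1 : (h i : Matrix n n ℂ) * star (W : Matrix n n ℂ) - (h i : Matrix n n ℂ) * star (W' : Matrix n n ℂ) =
              (h i : Matrix n n ℂ) * star ((W : Matrix n n ℂ) - W') := by rw [star_sub, mul_sub]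
          rw [h1]
          exact (norm_coe_mul_le _ _).trans (norm_star _).le
      _ = (∑ i, c i) * ((1 + r / (1 - r)) * ‖(W : Matrix n n ℂ) - W'‖) := by rw [Finset.sum_mul]
      _ ≤ (1 - κ) * ((1 + r / (1 - r)) * ‖(W : Matrix n n ℂ) - W'‖) :=
          mul_le_mul_of_nonneg_right hs (mul_nonneg (by have := div_nonneg hr0 (by linarith : (0:ℝ) ≤ 1 - r); linarith) (norm_nonneg _))
      _ = (1 - κ) * (1 + r / (1 - r)) * ‖(W : Matrix n n ℂ) - W'‖ := by ring
  -- on `S`, `exp (M W) = (K W) W*` is unitary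
  have hexp_eq : ∀ W ∈ S, exp (M W) = ((K W * W⁻¹ : Matrix.specialUnitaryGroup n ℂ) : Matrix n n ℂ) := by
    intro W hW
    rw [Submonoid.coe_mul, coe_inv_su, hKW W hW, mul_assoc, coe_mul_star_self, mul_one]
  have hexp_unit : ∀ W ∈ S, star (exp (M W)) * exp (M W) = 1 := by
    intro W hW; rw [hexp_eq W hW]; exact coe_star_mul_self _
  -- the iteration map
  set T : Matrix.specialUnitaryGroup n ℂ → Matrix.specialUnitaryGroup n ℂ := fun W => W * (K W)⁻¹ * Y with hT_def
  have hTcoe : ∀ W ∈ S, ((T W : Matrix.specialUnitaryGroup n ℂ) : Matrix n n ℂ) = star (exp (M W)) * (Y : Matrix n n ℂ) := by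
    intro W hW
    simp only [hT_def, Submonoid.coe_mul, coe_inv_su]
    rw [hKW W hW, star_mul, ← mul_assoc, coe_mul_star_self, one_mul]
  -- contraction constant
  set q : ℝ := 1 - κ / 2 with hq_def
  have hq0 : 0 ≤ q := by rw [hq_def]; linarith
  have hq1 : q < 1 := by rw [hq_def]; linarith
  have hLipq : (1 - κ) * (1 + r / (1 - r)) * Real.exp (2 * r) ≤ q := by
    have hne : (1 - r) ≠ 0 := by linarith
    have h1' : 1 + r / (1 - r) = (1 - r)⁻¹ := by field_simp; ring
    have h1 : (1 + r / (1 - r)) * Real.exp (2 * r) = Real.exp (2 * r) / (1 - r) := by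
      rw [h1', inv_mul_eq_div]
    have h2 : (1 + r / (1 - r)) * Real.exp (2 * r) ≤ 1 + 4 * r := by rw [h1]; exact exp_two_mul_div_le hr0 hr8
    calc (1 - κ) * (1 + r / (1 - r)) * Real.exp (2 * r) = (1 - κ) * ((1 + r / (1 - r)) * Real.exp (2 * r)) := by ring
      _ ≤ (1 - κ) * (1 + 4 * r) := mul_le_mul_of_nonneg_left h2 (by linarith)
      _ ≤ q := by rw [hq_def]; nlinarith
  -- the Lipschitz estimate of `T` on the ball
  have hTlip : ∀ W ∈ s, ∀ W' ∈ s,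
      ‖((T W : Matrix.specialUnitaryGroup n ℂ) : Matrix n n ℂ) - (T W' : Matrix n n ℂ)‖ ≤ q * ‖(W : Matrix n n ℂ) - W'‖ := by
    intro W hW W' hW'
    rw [hTcoe W (hsS hW), hTcoe W' (hsS hW'), ← sub_mul, ← star_sub]
    calc ‖star (exp (M W) - exp (M W')) * (Y : Matrix n n ℂ)‖ ≤ ‖star (exp (M W) - exp (M W'))‖ := norm_mul_coe_le _ _
      _ = ‖exp (M W) - exp (M W')‖ := norm_star _
      _ ≤ ‖M W - M W'‖ * Real.exp (max ‖M W‖ ‖M W'‖) := Literature.Analysis.Complex.norm_exp_sub_exp_le _ _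
      _ ≤ ((1 - κ) * (1 + r / (1 - r)) * ‖(W : Matrix n n ℂ) - W'‖) * Real.exp (2 * r) :=
          mul_le_mul (hMlip W hW W' hW') (Real.exp_le_exp.mpr (max_le (hMle W hW) (hMle W' hW'))) (Real.exp_pos _).le
            (mul_nonneg (mul_nonneg (by linarith) (by have := div_nonneg hr0 (by linarith : (0:ℝ) ≤ 1 - r); linarith)) (norm_nonneg _))
      _ = ((1 - κ) * (1 + r / (1 - r)) * Real.exp (2 * r)) * ‖(W : Matrix n n ℂ) - W'‖ := by ring
      _ ≤ q * ‖(W : Matrix n n ℂ) - W'‖ := mul_le_mul_of_nonneg_right hLipq (norm_nonneg _)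
  -- the first step
  have hT0 : ‖((T W₀ : Matrix.specialUnitaryGroup n ℂ) : Matrix n n ℂ) - W₀‖ ≤ η := by
    have hW₀S := hsS hW₀s
    have h1 : ((T W₀ : Matrix.specialUnitaryGroup n ℂ) : Matrix n n ℂ) - W₀ =
        star (exp (M W₀)) * ((Y : Matrix n n ℂ) - (K W₀ : Matrix n n ℂ)) := by
      rw [hTcoe W₀ hW₀S, hKW W₀ hW₀S, mul_sub, ← mul_assoc, hexp_unit W₀ hW₀S, one_mul]
    rw [h1, hexp_eq W₀ hW₀S, ← coe_inv_su]
    exact (norm_coe_mul_le _ _).trans hY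
  -- `T` maps the ball into itself
  have hmaps : MapsTo T s s := by
    intro W hW
    show ‖((T W : Matrix.specialUnitaryGroup n ℂ) : Matrix n n ℂ) - W₀‖ ≤ R
    have h1 : ((T W : Matrix.specialUnitaryGroup n ℂ) : Matrix n n ℂ) - W₀ =
        (((T W : Matrix.specialUnitaryGroup n ℂ) : Matrix n n ℂ) - (T W₀ : Matrix n n ℂ)) + (((T W₀ : Matrix.specialUnitaryGroup n ℂ) : Matrix n n ℂ) - W₀) := by abel
    rw [h1]
    refine (norm_add_le _ _).trans ?_
    have h2 := hTlip W hW W₀ hW₀s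
    have h3 : q * ‖(W : Matrix n n ℂ) - W₀‖ ≤ q * R := mul_le_mul_of_nonneg_left hW hq0
    have h4 : q * R + η = R := by
      rw [hq_def, hR_def]; field_simp; ring
    linarith
  -- completeness of the ball
  have hsc : IsComplete s := by
    have hclosed : IsClosed s :=
      isClosed_le ((continuous_subtype_val.sub continuous_const).norm) continuous_const
    exact hclosed.isComplete
  -- contraction
  have hK : ContractingWith ⟨q, hq0⟩ (hmaps.restrict T s s) := by
    refine ⟨by exact_mod_cast hq1, LipschitzWith.of_dist_le_mul fun W W' => ?_⟩
    simp only [Subtype.dist_eq, MapsTo.val_restrict_apply, dist_eq_norm]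
    exact hTlip _ W.2 _ W'.2
  obtain ⟨W, hWs, hfix, -⟩ := hK.exists_fixedPoint' hsc hmaps hW₀s (edist_ne_top _ _)
  refine ⟨W, hWs, ?_⟩
  -- a fixed point of `T` solves `K W = Y`
  have hfix' : W * (K W)⁻¹ * Y = W := hfix
  have h1 : (K W)⁻¹ * Y = 1 := by
    have := congrArg (fun Z => W⁻¹ * Z) hfix'
    simpa [← mul_assoc] using this
  calc K W = K W * ((K W)⁻¹ * Y) := by rw [h1, mul_one]
    _ = Y := by rw [← mul_assoc, mul_inv_cancel, one_mul]

end Engine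

end Summit.QuantumFields.YangMills.Theorems.BlockAvgCorrector

end
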